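import Summits.CriticalPhenomena.Ising3DConformalLimit.Theses.PerfectScreening
import Summits.CriticalPhenomena.Ising3DConformalLimit.Theses.PlantedPinning
import Summits.CriticalPhenomena.Ising3DConformalLimit.Theses.LeeYangGap
import Summits.CriticalPhenomena.Ising3DConformalLimit.Theses.SubPtolemyInterlacing
import Summits.CriticalPhenomena.Ising3DConformalLimit.Theses.EnergyNotSigmaSquared
import Summits.CriticalPhenomena.Ising3DConformalLimit.Theses.HyperoctahedralRP
import Summits.CriticalPhenomena.Ising3DConformalLimit.Theorems.PlantedPinningMoebiusLimitExistsLocalWard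
import Summits.CriticalPhenomena.Ising3DConformalLimit.Theorems.PlantedPinningMoebiusLimitExistsK1DoorTight
import Summits.CriticalPhenomena.Ising3DConformalLimit.Theorems.LeeYangGapMoebiusLimitExistsLatticeK1Door
import Summits.CriticalPhenomena.Ising3DConformalLimit.Theorems.PerfectScreeningMoebiusLimitExistsTwoLeaf
import Literature.Probability.LatticeModels.SCTWardIdentity
import Literature.MathematicalPhysics.QuantumFieldTheory.PointwiseOSReconstruction
import HarnessLib

/-!
# NEAR ONE CONFIGURATION: crux `MoebiusLimitExists` (stmt-CriticalPhenomena-1344) ⟺ item 1981 ∧ 7⁗_loc, item 1982 ⟺ the LOCAL `K_{e₀}` upgrade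
(line `Sketch` v13/v14, lead prover-line-stmt-CriticalPhenomena-1344-c18-0; THEOREM-ONLY, `--supports stmt-CriticalPhenomena-1344`)

By LOCAL-TO-GLOBAL (`MoebiusLimitExistsLocalWard.ward_of_localWard`: every Euclidean scale-covariant Ising₃ limit is real-analytic on the
whole path-connected configuration space, so a weak Ward identity near one configuration propagates to all of them) the registered residual of
skeleton v11/v12 — 7⁗, the single-generator (`K_{e₀}`) weak special-conformal Ward identity at the even levels `n ≥ 4` — is equivalent to its
GERM form **7⁗_loc**: at each even level `n ≥ 4` the `K_{e₀}` identity holds for the tests supported in SOME non-empty open set of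
non-coincident configurations.  This file records:

* `k1EvenGeFour_iff_localK1EvenGeFour_of_limit` — for normalised non-degenerate Euclidean scale-covariant limits of `criticalCorr 3`:
  7⁗-conclusion ⟺ 7⁗_loc-conclusion; `localK1EvenGeFour_iff_isMoebiusCovariant_of_limit` — and both ⟺ `IsMoebiusCovariant Δ S`;
* **item 1982 ⟺ the bare LOCAL `K_{e₀}` upgrade** (`inversionUpgradeNormalised_iff_localK1WardUpgrade`, registered anchor);
* **TIGHTNESS of v13/v14: crux ⟺ 1981 ∧ 7⁗_loc** (`MoebiusLimitExists_iff_existence_and_localK1WardStrict`, with the idle window / `U₄` / OS /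
  clustering premises of the registered stub `MoebiusLimitExistsSketchV13.stub_interiorWardK1Local`), the sufficiency direction in the
  PlantedPinning / LeeYangGap / SubPtolemyInterlacing / EnergyNotSigmaSquared spellings, and the LATTICE-LOCAL census line
  `MoebiusLimitExists_iff_existence_and_latticeLocalK1WardStrict`: crux ⟺ 1981 ∧ "at each even level `n ≥ 4`, on SOME non-empty open set of
  configurations, the rescaled critical `ℤ³` correlators satisfy the `K_{e₀}` Ward identity asymptotically in the weak sense".

So the census of kernel-checked equivalent residuals reads `crux ⟺ 1981 ∧ X`, X ∈ {1982, 7′, 7″, 7‴, 7⁗, 7⁗_lat, 7⁗_loc, 7⁗_loc,lat, 4840, 4671}: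
the conformal content of the 3D-Ising scaling limit is ONE linear first-order identity for ONE generator near ONE `n`-point configuration per
even level `n ≥ 4` — and, through the lattice door, an asymptotic statement about the critical correlators `⟨σ_[x₁/δ]⋯σ_[xₙ/δ]⟩⁺_{β_c}` for
configurations in an arbitrarily small open set.

References: Di Francesco–Mathieu–Sénéchal 1997 §4.3.1 (4.51)–(4.56) [FrancescoMathieuSenechal1997]; Glimm–Jaffe 1987 §6.1, §19.7
[GlimmJaffe1987]; Duminil-Copin, ICM 2022 §8.4 [DuminilCopinICM2022].  No definitions, no `sorry`.
-/

noncomputable section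

namespace Summit.CriticalPhenomena.Ising3DConformalLimit.MoebiusLimitExistsLocalWard

open Filter Topology MeasureTheory Set
open Literature.Probability.LatticeModels Literature.MathematicalPhysics.QuantumFieldTheory
open Summit.CriticalPhenomena.Ising3DConformalLimit.Theses
open Summit.CriticalPhenomena.Ising3DConformalLimit.MoebiusLimitExistsSketchV13 (stub_nonCoincident_pathConnected)
open Summit.CriticalPhenomena.Ising3DConformalLimit.MoebiusLimitExistsK1Door
  (isMoebiusCovariant_of_limit_of_k1EvenGeFour k1EvenGeFour_of_moebius inversionUpgradeNormalised_iff_k1WardUpgrade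
    MoebiusLimitExists_iff_existence_and_k1WardStrict MoebiusLimitExists_of_existence_of_k1WardStrict)
open Summit.CriticalPhenomena.Ising3DConformalLimit.MoebiusLimitExistsWardDoor (continuousOn_of_limit)
open Summit.CriticalPhenomena.Ising3DConformalLimit.MoebiusLimitExistsLatticeWard (integral_ward_eq_zero_iff_tendsto_lattice)

/-! ## 7⁗ ⟺ 7⁗_loc for limits, and both ⟺ Möbius covariance -/

/-- **GLOBAL from LOCAL** for the single generator `K_{e₀}` at the even levels `≥ 4` (`ward_of_localWard` with `b = e₀`, weight `Δ`).
[cite: GlimmJaffe1987, §6.1 Thm 6.1.3] -/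
theorem k1EvenGeFour_of_localK1EvenGeFour {ρ : ℝ → ℝ} {Δ : ℝ} {S : CorrFamily 3}
    (hρ : ∀ δ ∈ Set.Ioc (0:ℝ) 1, 0 < ρ δ) (hlim : HasPointwiseScalingLimit (criticalCorr 3) ρ S)
    (hnorm : ∀ n z, z ∉ NonCoincident 3 n → S n z = 0) (hnd : IsNondegenerateTwoPoint S)
    (heuc : IsEuclideanInvariant S) (hsc : IsScaleCovariant Δ S)
    (hloc : ∀ n, 4 ≤ n → Even n → ∃ V : Set (Fin n → EuclideanSpace ℝ (Fin 3)),
        IsOpen V ∧ V.Nonempty ∧ V ⊆ NonCoincident 3 n ∧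
        ∀ (φ : (Fin n → EuclideanSpace ℝ (Fin 3)) → ℝ),
          ContDiff ℝ ((⊤ : ℕ∞) : WithTop ℕ∞) φ → HasCompactSupport φ → tsupport φ ⊆ V →
          ∫ x, S n x * ((2 * Δ - 6) * (∑ i, inner ℝ (EuclideanSpace.single 0 1 : EuclideanSpace ℝ (Fin 3)) (x i)) * φ x +
            fderiv ℝ φ x (fun i => ‖x i‖ ^ 2 • (EuclideanSpace.single 0 1 : EuclideanSpace ℝ (Fin 3)) -
              (2 * inner ℝ (EuclideanSpace.single 0 1 : EuclideanSpace ℝ (Fin 3)) (x i)) • x i)) = 0) :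
    ∀ n, 4 ≤ n → Even n → ∀ (φ : (Fin n → EuclideanSpace ℝ (Fin 3)) → ℝ),
        ContDiff ℝ ((⊤ : ℕ∞) : WithTop ℕ∞) φ → HasCompactSupport φ → tsupport φ ⊆ NonCoincident 3 n →
        ∫ x, S n x * ((2 * Δ - 6) * (∑ i, inner ℝ (EuclideanSpace.single 0 1 : EuclideanSpace ℝ (Fin 3)) (x i)) * φ x +
          fderiv ℝ φ x (fun i => ‖x i‖ ^ 2 • (EuclideanSpace.single 0 1 : EuclideanSpace ℝ (Fin 3)) -
            (2 * inner ℝ (EuclideanSpace.single 0 1 : EuclideanSpace ℝ (Fin 3)) (x i)) • x i)) = 0 :=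
  fun n hn4 he => by
    obtain ⟨V, hV, hVne, hVsub, hV'⟩ := hloc n hn4 he
    exact ward_of_localWard hρ hlim hnorm hnd heuc hsc Δ (EuclideanSpace.single 0 1) hV hVne hVsub hV'

/-- **LOCAL from GLOBAL** (take `V = NonCoincident 3 n`, open and non-empty). [folklore] -/
theorem localK1EvenGeFour_of_k1EvenGeFour {Δ : ℝ} {S : CorrFamily 3}
    (hK1 : ∀ n, 4 ≤ n → Even n → ∀ (φ : (Fin n → EuclideanSpace ℝ (Fin 3)) → ℝ),
        ContDiff ℝ ((⊤ : ℕ∞) : WithTop ℕ∞) φ → HasCompactSupport φ → tsupport φ ⊆ NonCoincident 3 n →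
        ∫ x, S n x * ((2 * Δ - 6) * (∑ i, inner ℝ (EuclideanSpace.single 0 1 : EuclideanSpace ℝ (Fin 3)) (x i)) * φ x +
          fderiv ℝ φ x (fun i => ‖x i‖ ^ 2 • (EuclideanSpace.single 0 1 : EuclideanSpace ℝ (Fin 3)) -
            (2 * inner ℝ (EuclideanSpace.single 0 1 : EuclideanSpace ℝ (Fin 3)) (x i)) • x i)) = 0) :
    ∀ n, 4 ≤ n → Even n → ∃ V : Set (Fin n → EuclideanSpace ℝ (Fin 3)),
        IsOpen V ∧ V.Nonempty ∧ V ⊆ NonCoincident 3 n ∧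
        ∀ (φ : (Fin n → EuclideanSpace ℝ (Fin 3)) → ℝ),
          ContDiff ℝ ((⊤ : ℕ∞) : WithTop ℕ∞) φ → HasCompactSupport φ → tsupport φ ⊆ V →
          ∫ x, S n x * ((2 * Δ - 6) * (∑ i, inner ℝ (EuclideanSpace.single 0 1 : EuclideanSpace ℝ (Fin 3)) (x i)) * φ x +
            fderiv ℝ φ x (fun i => ‖x i‖ ^ 2 • (EuclideanSpace.single 0 1 : EuclideanSpace ℝ (Fin 3)) -
              (2 * inner ℝ (EuclideanSpace.single 0 1 : EuclideanSpace ℝ (Fin 3)) (x i)) • x i)) = 0 :=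
  fun n hn4 he => ⟨NonCoincident 3 n, isOpen_nonCoincident 3 n, (stub_nonCoincident_pathConnected n).nonempty,
    Subset.rfl, hK1 n hn4 he⟩

/-- **For normalised non-degenerate Euclidean scale-covariant limits of `criticalCorr 3`: 7⁗-conclusion ⟺ 7⁗_loc-conclusion.**
[cite: GlimmJaffe1987, §6.1 Thm 6.1.3] -/
theorem k1EvenGeFour_iff_localK1EvenGeFour_of_limit {ρ : ℝ → ℝ} {Δ : ℝ} {S : CorrFamily 3}
    (hρ : ∀ δ ∈ Set.Ioc (0:ℝ) 1, 0 < ρ δ) (hlim : HasPointwiseScalingLimit (criticalCorr 3) ρ S)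
    (hnorm : ∀ n z, z ∉ NonCoincident 3 n → S n z = 0) (hnd : IsNondegenerateTwoPoint S)
    (heuc : IsEuclideanInvariant S) (hsc : IsScaleCovariant Δ S) :
    (∀ n, 4 ≤ n → Even n → ∀ (φ : (Fin n → EuclideanSpace ℝ (Fin 3)) → ℝ),
        ContDiff ℝ ((⊤ : ℕ∞) : WithTop ℕ∞) φ → HasCompactSupport φ → tsupport φ ⊆ NonCoincident 3 n →
        ∫ x, S n x * ((2 * Δ - 6) * (∑ i, inner ℝ (EuclideanSpace.single 0 1 : EuclideanSpace ℝ (Fin 3)) (x i)) * φ x +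
          fderiv ℝ φ x (fun i => ‖x i‖ ^ 2 • (EuclideanSpace.single 0 1 : EuclideanSpace ℝ (Fin 3)) -
            (2 * inner ℝ (EuclideanSpace.single 0 1 : EuclideanSpace ℝ (Fin 3)) (x i)) • x i)) = 0) ↔
    (∀ n, 4 ≤ n → Even n → ∃ V : Set (Fin n → EuclideanSpace ℝ (Fin 3)),
        IsOpen V ∧ V.Nonempty ∧ V ⊆ NonCoincident 3 n ∧
        ∀ (φ : (Fin n → EuclideanSpace ℝ (Fin 3)) → ℝ),
          ContDiff ℝ ((⊤ : ℕ∞) : WithTop ℕ∞) φ → HasCompactSupport φ → tsupport φ ⊆ V →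
          ∫ x, S n x * ((2 * Δ - 6) * (∑ i, inner ℝ (EuclideanSpace.single 0 1 : EuclideanSpace ℝ (Fin 3)) (x i)) * φ x +
            fderiv ℝ φ x (fun i => ‖x i‖ ^ 2 • (EuclideanSpace.single 0 1 : EuclideanSpace ℝ (Fin 3)) -
              (2 * inner ℝ (EuclideanSpace.single 0 1 : EuclideanSpace ℝ (Fin 3)) (x i)) • x i)) = 0) :=
  ⟨localK1EvenGeFour_of_k1EvenGeFour, k1EvenGeFour_of_localK1EvenGeFour hρ hlim hnorm hnd heuc hsc⟩

/-- **The `K_{e₀}` identities near one configuration per even level `≥ 4` ARE Möbius covariance**, for normalised non-degenerate Euclidean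
scale-covariant limits of `criticalCorr 3` (local-to-global, then `k1EvenGeFour_iff_isMoebiusCovariant_of_limit`).
[cite: FrancescoMathieuSenechal1997, §4.3.1 (4.51)–(4.56)] -/
theorem localK1EvenGeFour_iff_isMoebiusCovariant_of_limit {ρ : ℝ → ℝ} {Δ : ℝ} {S : CorrFamily 3}
    (hρ : ∀ δ ∈ Set.Ioc (0:ℝ) 1, 0 < ρ δ) (hlim : HasPointwiseScalingLimit (criticalCorr 3) ρ S)
    (hnorm : ∀ n z, z ∉ NonCoincident 3 n → S n z = 0) (hnd : IsNondegenerateTwoPoint S)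
    (heuc : IsEuclideanInvariant S) (hsc : IsScaleCovariant Δ S) :
    (∀ n, 4 ≤ n → Even n → ∃ V : Set (Fin n → EuclideanSpace ℝ (Fin 3)),
        IsOpen V ∧ V.Nonempty ∧ V ⊆ NonCoincident 3 n ∧
        ∀ (φ : (Fin n → EuclideanSpace ℝ (Fin 3)) → ℝ),
          ContDiff ℝ ((⊤ : ℕ∞) : WithTop ℕ∞) φ → HasCompactSupport φ → tsupport φ ⊆ V →
          ∫ x, S n x * ((2 * Δ - 6) * (∑ i, inner ℝ (EuclideanSpace.single 0 1 : EuclideanSpace ℝ (Fin 3)) (x i)) * φ x +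
            fderiv ℝ φ x (fun i => ‖x i‖ ^ 2 • (EuclideanSpace.single 0 1 : EuclideanSpace ℝ (Fin 3)) -
              (2 * inner ℝ (EuclideanSpace.single 0 1 : EuclideanSpace ℝ (Fin 3)) (x i)) • x i)) = 0) ↔
      IsMoebiusCovariant Δ S :=
  ⟨fun h => isMoebiusCovariant_of_limit_of_k1EvenGeFour hlim hnorm heuc hsc
      (k1EvenGeFour_of_localK1EvenGeFour hρ hlim hnorm hnd heuc hsc h),
    fun h => localK1EvenGeFour_of_k1EvenGeFour (k1EvenGeFour_of_moebius (continuousOn_of_limit hlim) h)⟩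

/-! ## Item 1982 ⟺ the bare LOCAL `K_{e₀}` upgrade (registered anchor) -/

/-- **Item 1982 ⟺ the bare local single-generator even-level Ward upgrade**: every normalised non-degenerate Euclidean scale-covariant
pointwise limit of the critical `ℤ³` correlators is inversion covariant iff for every such limit and every even `n ≥ 4` the weak `K_{e₀}`
identity holds for the tests supported in SOME non-empty open set of non-coincident configurations.
[cite: FrancescoMathieuSenechal1997, §4.3.1 eq. (4.62)] -/
theorem inversionUpgradeNormalised_iff_localK1WardUpgrade : Summit.CriticalPhenomena.Ising3DConformalLimit.Theses.HyperoctahedralRP.InversionUpgradeNormalised ↔ (∀ (ρ : ℝ → ℝ) (Δ : ℝ) (S : Literature.Probability.LatticeModels.CorrFamily 3), (∀ δ ∈ Set.Ioc (0:ℝ) 1, 0 < ρ δ) → Literature.Probability.LatticeModels.HasPointwiseScalingLimit (Literature.Probability.LatticeModels.criticalCorr 3) ρ S → (∀ n z, z ∉ Literature.Probability.LatticeModels.NonCoincident 3 n → S n z = 0) → Literature.Probability.LatticeModels.IsNondegenerateTwoPoint S → Literature.Probability.LatticeModels.IsEuclideanInvariant S → Literature.Probability.LatticeModels.IsScaleCovariant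 Δ S → ∀ n, 4 ≤ n → Even n → ∃ V : Set (Fin n → EuclideanSpace ℝ (Fin 3)), IsOpen V ∧ V.Nonempty ∧ V ⊆ Literature.Probability.LatticeModels.NonCoincident 3 n ∧ ∀ (φ : (Fin n → EuclideanSpace ℝ (Fin 3)) → ℝ), ContDiff ℝ ((⊤ : ℕ∞) : WithTop ℕ∞) φ → HasCompactSupport φ → tsupport φ ⊆ V → MeasureTheory.integral MeasureTheory.volume (fun x => S n x * ((2 * Δ - 6) * (∑ i, inner ℝ (EuclideanSpace.single 0 1 : EuclideanSpace ℝ (Fin 3)) (x i)) * φ x + fderiv ℝ φ x (fun i => ‖x i‖ ^ 2 • (EuclideanSpace.single 0 1 : EuclideanSpace ℝ (Fin 3)) - (2 * inner ℝ (EuclideanSpace.single 0 1 : EuclideanSpace ℝ (Fin 3)) (x i)) • x i))) = 0) := by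
  rw [inversionUpgradeNormalised_iff_k1WardUpgrade]
  refine forall_congr' fun ρ => forall_congr' fun Δ => forall_congr' fun S => forall_congr' fun hρ =>
    forall_congr' fun hlim => forall_congr' fun hnorm => forall_congr' fun hnd => forall_congr' fun heuc =>
    forall_congr' fun hsc => ?_
  exact k1EvenGeFour_iff_localK1EvenGeFour_of_limit hρ hlim hnorm hnd heuc hsc

/-! ## The crux ⟺ item 1981 ∧ 7⁗_loc (the registered residual of skeleton v13/v14) -/

/-- **TIGHTNESS of skeleton v13/v14: `MoebiusLimitExists ⟺ ExistsScaleCovariantLimit (1981) ∧ 7⁗_loc`** — the reshape 7⁗ → 7⁗_loc drops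
no content and the germ residual is necessary. [cite: DuminilCopinICM2022, §8.4] -/
theorem MoebiusLimitExists_iff_existence_and_localK1WardStrict :
    PerfectScreening.MoebiusLimitExists ↔
      HyperoctahedralRP.ExistsScaleCovariantLimit ∧
      (∀ (ρ : ℝ → ℝ) (Δ : ℝ) (S : CorrFamily 3), (∀ δ ∈ Set.Ioc (0:ℝ) 1, 0 < ρ δ) →
        HasPointwiseScalingLimit (criticalCorr 3) ρ S → (∀ n z, z ∉ NonCoincident 3 n → S n z = 0) →
        IsNondegenerateTwoPoint S → IsEuclideanInvariant S → IsScaleCovariant Δ S →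
        1 / 2 < Δ → Δ ≤ 3 / 4 → HasNontrivialU4 S →
        (∀ τ : Fin 3, PointwiseOSReconstruction τ S) →
        (∀ (n m : ℕ) (x : Fin n → EuclideanSpace ℝ (Fin 3)) (y : Fin m → EuclideanSpace ℝ (Fin 3))
          (v : EuclideanSpace ℝ (Fin 3)), v ≠ 0 →
          Tendsto (fun t : ℝ => S (n + m) (Fin.append x (fun j => y j + t • v)) - S n x * S m y)
            atTop (𝓝 0)) →
        ∀ n, 4 ≤ n → Even n → ∃ V : Set (Fin n → EuclideanSpace ℝ (Fin 3)),
          IsOpen V ∧ V.Nonempty ∧ V ⊆ NonCoincident 3 n ∧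
          ∀ (φ : (Fin n → EuclideanSpace ℝ (Fin 3)) → ℝ),
            ContDiff ℝ ((⊤ : ℕ∞) : WithTop ℕ∞) φ → HasCompactSupport φ → tsupport φ ⊆ V →
            ∫ x, S n x * ((2 * Δ - 6) * (∑ i, inner ℝ (EuclideanSpace.single 0 1 : EuclideanSpace ℝ (Fin 3)) (x i)) * φ x +
              fderiv ℝ φ x (fun i => ‖x i‖ ^ 2 • (EuclideanSpace.single 0 1 : EuclideanSpace ℝ (Fin 3)) -
                (2 * inner ℝ (EuclideanSpace.single 0 1 : EuclideanSpace ℝ (Fin 3)) (x i)) • x i)) = 0) := by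
  rw [MoebiusLimitExists_iff_existence_and_k1WardStrict]
  refine and_congr_right fun _ => ?_
  refine forall_congr' fun ρ => forall_congr' fun Δ => forall_congr' fun S => forall_congr' fun hρ =>
    forall_congr' fun hlim => forall_congr' fun hnorm => forall_congr' fun hnd => forall_congr' fun heuc =>
    forall_congr' fun hsc => ?_
  exact forall_congr' fun _ => forall_congr' fun _ => forall_congr' fun _ => forall_congr' fun _ =>
    forall_congr' fun _ => k1EvenGeFour_iff_localK1EvenGeFour_of_limit hρ hlim hnorm hnd heuc hsc

/-- **The crux ⇐ item 1981 ∧ 7⁗_loc** (the composition of skeleton v14). [cite: DuminilCopinICM2022, §8.4] -/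
theorem MoebiusLimitExists_of_existence_of_localK1WardStrict
    (hE : HyperoctahedralRP.ExistsScaleCovariantLimit)
    (h7 : ∀ (ρ : ℝ → ℝ) (Δ : ℝ) (S : CorrFamily 3), (∀ δ ∈ Set.Ioc (0:ℝ) 1, 0 < ρ δ) →
        HasPointwiseScalingLimit (criticalCorr 3) ρ S → (∀ n z, z ∉ NonCoincident 3 n → S n z = 0) →
        IsNondegenerateTwoPoint S → IsEuclideanInvariant S → IsScaleCovariant Δ S →
        1 / 2 < Δ → Δ ≤ 3 / 4 → HasNontrivialU4 S →
        (∀ τ : Fin 3, PointwiseOSReconstruction τ S) →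
        (∀ (n m : ℕ) (x : Fin n → EuclideanSpace ℝ (Fin 3)) (y : Fin m → EuclideanSpace ℝ (Fin 3))
          (v : EuclideanSpace ℝ (Fin 3)), v ≠ 0 →
          Tendsto (fun t : ℝ => S (n + m) (Fin.append x (fun j => y j + t • v)) - S n x * S m y)
            atTop (𝓝 0)) →
        ∀ n, 4 ≤ n → Even n → ∃ V : Set (Fin n → EuclideanSpace ℝ (Fin 3)),
          IsOpen V ∧ V.Nonempty ∧ V ⊆ NonCoincident 3 n ∧
          ∀ (φ : (Fin n → EuclideanSpace ℝ (Fin 3)) → ℝ),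
            ContDiff ℝ ((⊤ : ℕ∞) : WithTop ℕ∞) φ → HasCompactSupport φ → tsupport φ ⊆ V →
            ∫ x, S n x * ((2 * Δ - 6) * (∑ i, inner ℝ (EuclideanSpace.single 0 1 : EuclideanSpace ℝ (Fin 3)) (x i)) * φ x +
              fderiv ℝ φ x (fun i => ‖x i‖ ^ 2 • (EuclideanSpace.single 0 1 : EuclideanSpace ℝ (Fin 3)) -
                (2 * inner ℝ (EuclideanSpace.single 0 1 : EuclideanSpace ℝ (Fin 3)) (x i)) • x i)) = 0) :
    PerfectScreening.MoebiusLimitExists :=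
  MoebiusLimitExists_iff_existence_and_localK1WardStrict.2 ⟨hE, h7⟩

/-- Route PlantedPinning's spelling of the sufficiency direction. [cite: DuminilCopinICM2022, §8.4] -/
theorem plantedPinning_MoebiusLimitExists_of_existence_of_localK1WardStrict
    (hE : HyperoctahedralRP.ExistsScaleCovariantLimit)
    (h7 : ∀ (ρ : ℝ → ℝ) (Δ : ℝ) (S : CorrFamily 3), (∀ δ ∈ Set.Ioc (0:ℝ) 1, 0 < ρ δ) →
        HasPointwiseScalingLimit (criticalCorr 3) ρ S → (∀ n z, z ∉ NonCoincident 3 n → S n z = 0) →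
        IsNondegenerateTwoPoint S → IsEuclideanInvariant S → IsScaleCovariant Δ S →
        1 / 2 < Δ → Δ ≤ 3 / 4 → HasNontrivialU4 S →
        (∀ τ : Fin 3, PointwiseOSReconstruction τ S) →
        (∀ (n m : ℕ) (x : Fin n → EuclideanSpace ℝ (Fin 3)) (y : Fin m → EuclideanSpace ℝ (Fin 3))
          (v : EuclideanSpace ℝ (Fin 3)), v ≠ 0 →
          Tendsto (fun t : ℝ => S (n + m) (Fin.append x (fun j => y j + t • v)) - S n x * S m y)
            atTop (𝓝 0)) →
        ∀ n, 4 ≤ n → Even n → ∃ V : Set (Fin n → EuclideanSpace ℝ (Fin 3)),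
          IsOpen V ∧ V.Nonempty ∧ V ⊆ NonCoincident 3 n ∧
          ∀ (φ : (Fin n → EuclideanSpace ℝ (Fin 3)) → ℝ),
            ContDiff ℝ ((⊤ : ℕ∞) : WithTop ℕ∞) φ → HasCompactSupport φ → tsupport φ ⊆ V →
            ∫ x, S n x * ((2 * Δ - 6) * (∑ i, inner ℝ (EuclideanSpace.single 0 1 : EuclideanSpace ℝ (Fin 3)) (x i)) * φ x +
              fderiv ℝ φ x (fun i => ‖x i‖ ^ 2 • (EuclideanSpace.single 0 1 : EuclideanSpace ℝ (Fin 3)) -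
                (2 * inner ℝ (EuclideanSpace.single 0 1 : EuclideanSpace ℝ (Fin 3)) (x i)) • x i)) = 0) :
    PlantedPinning.MoebiusLimitExists :=
  MoebiusLimitExists_of_existence_of_localK1WardStrict hE h7

/-- Route LeeYangGap's spelling. [cite: DuminilCopinICM2022, §8.4] -/
theorem leeYangGap_MoebiusLimitExists_of_existence_of_localK1WardStrict
    (hE : HyperoctahedralRP.ExistsScaleCovariantLimit)
    (h7 : ∀ (ρ : ℝ → ℝ) (Δ : ℝ) (S : CorrFamily 3), (∀ δ ∈ Set.Ioc (0:ℝ) 1, 0 < ρ δ) →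
        HasPointwiseScalingLimit (criticalCorr 3) ρ S → (∀ n z, z ∉ NonCoincident 3 n → S n z = 0) →
        IsNondegenerateTwoPoint S → IsEuclideanInvariant S → IsScaleCovariant Δ S →
        1 / 2 < Δ → Δ ≤ 3 / 4 → HasNontrivialU4 S →
        (∀ τ : Fin 3, PointwiseOSReconstruction τ S) →
        (∀ (n m : ℕ) (x : Fin n → EuclideanSpace ℝ (Fin 3)) (y : Fin m → EuclideanSpace ℝ (Fin 3))
          (v : EuclideanSpace ℝ (Fin 3)), v ≠ 0 →
          Tendsto (fun t : ℝ => S (n + m) (Fin.append x (fun j => y j + t • v)) - S n x * S m y)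
            atTop (𝓝 0)) →
        ∀ n, 4 ≤ n → Even n → ∃ V : Set (Fin n → EuclideanSpace ℝ (Fin 3)),
          IsOpen V ∧ V.Nonempty ∧ V ⊆ NonCoincident 3 n ∧
          ∀ (φ : (Fin n → EuclideanSpace ℝ (Fin 3)) → ℝ),
            ContDiff ℝ ((⊤ : ℕ∞) : WithTop ℕ∞) φ → HasCompactSupport φ → tsupport φ ⊆ V →
            ∫ x, S n x * ((2 * Δ - 6) * (∑ i, inner ℝ (EuclideanSpace.single 0 1 : EuclideanSpace ℝ (Fin 3)) (x i)) * φ x +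
              fderiv ℝ φ x (fun i => ‖x i‖ ^ 2 • (EuclideanSpace.single 0 1 : EuclideanSpace ℝ (Fin 3)) -
                (2 * inner ℝ (EuclideanSpace.single 0 1 : EuclideanSpace ℝ (Fin 3)) (x i)) • x i)) = 0) :
    LeeYangGap.MoebiusLimitExists :=
  MoebiusLimitExists_of_existence_of_localK1WardStrict hE h7

/-- Route SubPtolemyInterlacing's spelling (decl `MoebiusLimit`). [cite: DuminilCopinICM2022, §8.4] -/
theorem subPtolemyInterlacing_MoebiusLimit_of_existence_of_localK1WardStrict
    (hE : HyperoctahedralRP.ExistsScaleCovariantLimit)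
    (h7 : ∀ (ρ : ℝ → ℝ) (Δ : ℝ) (S : CorrFamily 3), (∀ δ ∈ Set.Ioc (0:ℝ) 1, 0 < ρ δ) →
        HasPointwiseScalingLimit (criticalCorr 3) ρ S → (∀ n z, z ∉ NonCoincident 3 n → S n z = 0) →
        IsNondegenerateTwoPoint S → IsEuclideanInvariant S → IsScaleCovariant Δ S →
        1 / 2 < Δ → Δ ≤ 3 / 4 → HasNontrivialU4 S →
        (∀ τ : Fin 3, PointwiseOSReconstruction τ S) →
        (∀ (n m : ℕ) (x : Fin n → EuclideanSpace ℝ (Fin 3)) (y : Fin m → EuclideanSpace ℝ (Fin 3))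
          (v : EuclideanSpace ℝ (Fin 3)), v ≠ 0 →
          Tendsto (fun t : ℝ => S (n + m) (Fin.append x (fun j => y j + t • v)) - S n x * S m y)
            atTop (𝓝 0)) →
        ∀ n, 4 ≤ n → Even n → ∃ V : Set (Fin n → EuclideanSpace ℝ (Fin 3)),
          IsOpen V ∧ V.Nonempty ∧ V ⊆ NonCoincident 3 n ∧
          ∀ (φ : (Fin n → EuclideanSpace ℝ (Fin 3)) → ℝ),
            ContDiff ℝ ((⊤ : ℕ∞) : WithTop ℕ∞) φ → HasCompactSupport φ → tsupport φ ⊆ V →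
            ∫ x, S n x * ((2 * Δ - 6) * (∑ i, inner ℝ (EuclideanSpace.single 0 1 : EuclideanSpace ℝ (Fin 3)) (x i)) * φ x +
              fderiv ℝ φ x (fun i => ‖x i‖ ^ 2 • (EuclideanSpace.single 0 1 : EuclideanSpace ℝ (Fin 3)) -
                (2 * inner ℝ (EuclideanSpace.single 0 1 : EuclideanSpace ℝ (Fin 3)) (x i)) • x i)) = 0) :
    SubPtolemyInterlacing.MoebiusLimit :=
  MoebiusLimitExists_of_existence_of_localK1WardStrict hE h7

/-- Route EnergyNotSigmaSquared's spelling (decl `MoebiusLimit`). [cite: DuminilCopinICM2022, §8.4] -/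
theorem energyNotSigmaSquared_MoebiusLimit_of_existence_of_localK1WardStrict
    (hE : HyperoctahedralRP.ExistsScaleCovariantLimit)
    (h7 : ∀ (ρ : ℝ → ℝ) (Δ : ℝ) (S : CorrFamily 3), (∀ δ ∈ Set.Ioc (0:ℝ) 1, 0 < ρ δ) →
        HasPointwiseScalingLimit (criticalCorr 3) ρ S → (∀ n z, z ∉ NonCoincident 3 n → S n z = 0) →
        IsNondegenerateTwoPoint S → IsEuclideanInvariant S → IsScaleCovariant Δ S →
        1 / 2 < Δ → Δ ≤ 3 / 4 → HasNontrivialU4 S →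
        (∀ τ : Fin 3, PointwiseOSReconstruction τ S) →
        (∀ (n m : ℕ) (x : Fin n → EuclideanSpace ℝ (Fin 3)) (y : Fin m → EuclideanSpace ℝ (Fin 3))
          (v : EuclideanSpace ℝ (Fin 3)), v ≠ 0 →
          Tendsto (fun t : ℝ => S (n + m) (Fin.append x (fun j => y j + t • v)) - S n x * S m y)
            atTop (𝓝 0)) →
        ∀ n, 4 ≤ n → Even n → ∃ V : Set (Fin n → EuclideanSpace ℝ (Fin 3)),
          IsOpen V ∧ V.Nonempty ∧ V ⊆ NonCoincident 3 n ∧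
          ∀ (φ : (Fin n → EuclideanSpace ℝ (Fin 3)) → ℝ),
            ContDiff ℝ ((⊤ : ℕ∞) : WithTop ℕ∞) φ → HasCompactSupport φ → tsupport φ ⊆ V →
            ∫ x, S n x * ((2 * Δ - 6) * (∑ i, inner ℝ (EuclideanSpace.single 0 1 : EuclideanSpace ℝ (Fin 3)) (x i)) * φ x +
              fderiv ℝ φ x (fun i => ‖x i‖ ^ 2 • (EuclideanSpace.single 0 1 : EuclideanSpace ℝ (Fin 3)) -
                (2 * inner ℝ (EuclideanSpace.single 0 1 : EuclideanSpace ℝ (Fin 3)) (x i)) • x i)) = 0) :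
    EnergyNotSigmaSquared.MoebiusLimit :=
  MoebiusLimitExists_of_existence_of_localK1WardStrict hE h7

/-! ## The LATTICE-LOCAL census line -/

/-- **One test at a time inside `V`**: for a pointwise limit of `criticalCorr 3`, a local weak Ward identity is equivalent to its asymptotic
lattice form (`integral_ward_eq_zero_iff_tendsto_lattice` per test function supported in `V ⊆ NonCoincident 3 n`). [cite: FrancescoMathieuSenechal1997, §4.3.1 (4.51)–(4.54)] -/
theorem localWard_iff_latticeLocalWard {ρ : ℝ → ℝ} {S : CorrFamily 3} (hlim : HasPointwiseScalingLimit (criticalCorr 3) ρ S)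
    (Δ : ℝ) {n : ℕ} (b : EuclideanSpace ℝ (Fin 3)) {V : Set (Fin n → EuclideanSpace ℝ (Fin 3))} (hVsub : V ⊆ NonCoincident 3 n) :
    (∀ (φ : (Fin n → EuclideanSpace ℝ (Fin 3)) → ℝ),
        ContDiff ℝ ((⊤ : ℕ∞) : WithTop ℕ∞) φ → HasCompactSupport φ → tsupport φ ⊆ V →
        ∫ x, S n x * ((2 * Δ - 6) * (∑ i, inner ℝ b (x i)) * φ x +
          fderiv ℝ φ x (fun i => ‖x i‖ ^ 2 • b - (2 * inner ℝ b (x i)) • x i)) = 0) ↔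
    (∀ (φ : (Fin n → EuclideanSpace ℝ (Fin 3)) → ℝ),
        ContDiff ℝ ((⊤ : ℕ∞) : WithTop ℕ∞) φ → HasCompactSupport φ → tsupport φ ⊆ V →
        Tendsto (fun δ => ∫ x, rescaledCorrelator (criticalCorr 3) ρ n δ x *
            ((2 * Δ - 6) * (∑ i, inner ℝ b (x i)) * φ x +
              fderiv ℝ φ x (fun i => ‖x i‖ ^ 2 • b - (2 * inner ℝ b (x i)) • x i)))
          (𝓝[>] (0:ℝ)) (𝓝 0)) :=
  forall_congr' fun _ => forall_congr' fun hφ => forall_congr' fun hφc => forall_congr' fun hsupp =>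
    integral_ward_eq_zero_iff_tendsto_lattice hlim Δ b hφ hφc (hsupp.trans hVsub)

/-- **LATTICE-LOCAL CENSUS LINE: crux ⟺ item 1981 ∧ 7⁗_loc,lat** — item 1981 plus: along every interacting open-window limit datum
`(ρ, Δ)`, at each even level `n ≥ 4`, on SOME non-empty open set `V` of non-coincident configurations the rescaled critical `ℤ³` correlators
satisfy the `K_{e₀}` Ward identity asymptotically in the weak sense, `∫ ρ(δ)ⁿ ⟨σ_[x₁/δ]⋯σ_[xₙ/δ]⟩⁺_{β_c} 𝒦ᵀ_{e₀}φ(x) dx → 0` (`δ → 0⁺`) for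
all smooth `φ` compactly supported in `V`. [cite: DuminilCopinICM2022, §8.4] -/
theorem MoebiusLimitExists_iff_existence_and_latticeLocalK1WardStrict :
    PerfectScreening.MoebiusLimitExists ↔
      HyperoctahedralRP.ExistsScaleCovariantLimit ∧
      (∀ (ρ : ℝ → ℝ) (Δ : ℝ) (S : CorrFamily 3), (∀ δ ∈ Set.Ioc (0:ℝ) 1, 0 < ρ δ) →
        HasPointwiseScalingLimit (criticalCorr 3) ρ S → (∀ n z, z ∉ NonCoincident 3 n → S n z = 0) →
        IsNondegenerateTwoPoint S → IsEuclideanInvariant S → IsScaleCovariant Δ S →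
        1 / 2 < Δ → Δ ≤ 3 / 4 → HasNontrivialU4 S →
        (∀ τ : Fin 3, PointwiseOSReconstruction τ S) →
        (∀ (n m : ℕ) (x : Fin n → EuclideanSpace ℝ (Fin 3)) (y : Fin m → EuclideanSpace ℝ (Fin 3))
          (v : EuclideanSpace ℝ (Fin 3)), v ≠ 0 →
          Tendsto (fun t : ℝ => S (n + m) (Fin.append x (fun j => y j + t • v)) - S n x * S m y)
            atTop (𝓝 0)) →
        ∀ n, 4 ≤ n → Even n → ∃ V : Set (Fin n → EuclideanSpace ℝ (Fin 3)),
          IsOpen V ∧ V.Nonempty ∧ V ⊆ NonCoincident 3 n ∧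
          ∀ (φ : (Fin n → EuclideanSpace ℝ (Fin 3)) → ℝ),
            ContDiff ℝ ((⊤ : ℕ∞) : WithTop ℕ∞) φ → HasCompactSupport φ → tsupport φ ⊆ V →
            Tendsto (fun δ => ∫ x, rescaledCorrelator (criticalCorr 3) ρ n δ x *
                ((2 * Δ - 6) * (∑ i, inner ℝ (EuclideanSpace.single 0 1 : EuclideanSpace ℝ (Fin 3)) (x i)) * φ x +
                  fderiv ℝ φ x (fun i => ‖x i‖ ^ 2 • (EuclideanSpace.single 0 1 : EuclideanSpace ℝ (Fin 3)) -
                    (2 * inner ℝ (EuclideanSpace.single 0 1 : EuclideanSpace ℝ (Fin 3)) (x i)) • x i)))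
              (𝓝[>] (0:ℝ)) (𝓝 0)) := by
  rw [MoebiusLimitExists_iff_existence_and_localK1WardStrict]
  refine and_congr_right fun _ => ?_
  refine forall_congr' fun ρ => forall_congr' fun Δ => forall_congr' fun S => forall_congr' fun _ =>
    forall_congr' fun hlim => ?_
  refine forall_congr' fun _ => forall_congr' fun _ => forall_congr' fun _ => forall_congr' fun _ =>
    forall_congr' fun _ => forall_congr' fun _ => forall_congr' fun _ => forall_congr' fun _ =>
    forall_congr' fun _ => forall_congr' fun n => forall_congr' fun _ => forall_congr' fun _ => ?_
  exact exists_congr fun V => and_congr_right fun _ => and_congr_right fun _ => and_congr_right fun hVsub =>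
    localWard_iff_latticeLocalWard hlim Δ (EuclideanSpace.single 0 1) hVsub

end Summit.CriticalPhenomena.Ising3DConformalLimit.MoebiusLimitExistsLocalWard

end
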